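import Summits.NavierStokesRegularity.FluidComputer.PalasekTowerHeredityWitness
import Summits.NavierStokesRegularity.FluidComputer.PalasekTowerClayBridgePathB

/-!
# REGISTER v2.3′: the heredity-witness reduction is UNCONDITIONAL — W14 drops out at every level

Cell `ns-blowup`, seat `ns-blowup-ecbridge-6` (g2; D-0074 GROUP C «BRIDGE SUPPORT»; bears_on LADDER-NS
N1, route `PalasekTowerBreakdown`, items stmt-NavierStokesRegularity-19249 `HeredityAtOne` (split
child of 19178 `EpisodeInduction` = `EpisodeInductionG`), 19250 `HeredityFromTwo`, 19179 `EpisodeBase`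
= `RungG 1`). Companion of `PalasekTowerHeredityWitness.lean` (p417894: `Schedule.LevelWitness`,
`HeredityWitness k`, THE REDUCTION `Stage.nonempty_extends_of_levelWitness` GIVEN forced
unconditional uniqueness `hU` = W14), `PalasekTowerHeredityWitnessRungs.lean` (p418125) and
`PalasekTowerHeredityAtOneWitness.lean` (p419314), whose reductions are all conditional on `hU`.
LABEL: E–C typing (KERNEL bookkeeping; every statement here is PROVED, no `Prop` is introduced).
WHAT THIS IS NOT: not Navier–Stokes evidence — no stage, flow or tower is constructed or claimed;
`HeredityWitness k` stays a HYPOTHESIS that numerical (MODEL) «tower words» may be booked against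
as analogues, never instances; nothing here asserts it, nor regularity, nor blow-up.

## What is proved

* §1 **A bounded classical competitor is unique among finite-energy classical solutions — no W14.**
  For a Clay-class force (smooth on `[0,∞) × ℝ³` with Fefferman's decay (5)), `ν > 0`, two
  classical solutions of the forced system on the closed slab `[0, T] × ℝ³` with finite energy and
  the same datum, ONE of which is bounded, coincide (`velocity_eq_of_bounded_classical`). Proof:
  both are Leray–Hopf weak solutions WITH the force (Tao 2013 Lemma 4.1 (i) with force in its
  corrected a.e. form — the tree THEOREM `tao2011_forced_pressure_normalisation_ae_holds` — through
  `isLerayHopfOn_of_clayForce'`); the bounded one lies in the Serrin class `L⁴(0,T;L⁶)`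
  (`memLqLp_four_six_of_bounded`); the force is a.e. jointly measurable and in `L²((0,T) × ℝ³)`
  (`clayForce_aestronglyMeasurable_prod'`, `clayForce_eLpNorm_prod_lt_top'`); Sohr's forced
  Serrin–Masuda weak–strong uniqueness — the tree THEOREM `serrinMasuda_weak_strong_uniqueness_forced`
  (Sohr 2001 Thm. V.1.5.1) — identifies them a.e., and continuity upgrades a.e. to everywhere.
* §1′ Hence **a registered stage pins the design's flow on its slab, unconditionally**: every
  classical finite-energy solution of the design's forced system from the Clay datum on a slab
  `[0, T'] ⊇ [0, τ k]` agrees with EVERY stage at level `k` (any margins, rates, viscosity) on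
  `[0, τ k]` — the stage is the bounded competitor, by its own register ceiling `c₂ Y_k`
  (`Stage.velocity_eq_of_classical`). Corollaries: `Stage.velocity_eq_of_le'`, `Stage.velocity_eq'`,
  `Stage.velocity_extends'` — the W14-free twins of `PalasekTowerStageUniqueness`'s lemmas — and
  `Stage.velocity_eq_of_window_ceiling` (a continuation past `τ k` carrying the next window ceiling,
  e.g. a level witness, is THE finite-energy classical flow of the design up to `τ (k+1)`: the
  `k ≤ 1` corner of `PalasekTowerRegisterGlobalHalves`, now without W14 for witness-shaped flows).
* §2 **The stage-relative form of the reduction needs no uniqueness at all**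
  (`Stage.exists_extends_of_velocity_continuation`; answers ecbridge-5's remark «typed relative to
  the earned stage the reduction is unconditional»): a classical finite-energy solution on
  `[0, τ (k+1)]` agreeing with the stage IN VELOCITY on `[0, τ k]` (any pressure gauge), below
  `c₂ Y_{k+1}` on the growth window and meeting the three floors of level `k + 1`, extends the stage —
  the pressures differ on `[0, τ k]` by a function of time alone (`pressure_gauge_eq_of_velocity_eq`),
  smoothly extended past `τ k` by Seeley (`exists_contDiffOn_Ici_extension`), so the re-gauged
  continuation agrees in velocity AND pressure; `Stage.exists_extends_of_continuation` assembles.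
* §3 **THE REDUCTION, UNCONDITIONAL** (`Stage.nonempty_extends_of_levelWitness'`, any rates, any
  `ν > 0`): a level witness of a design extends every registered stage of that design at that level
  — §1′ supplies the velocity agreement that p417894 took from `hU`, §2 does the rest.
* The unit-viscosity / wide-rates corollaries — every `hU`-conditional link of p418125 / p419314
  holding outright (`heredityAtOne_iff_heredityWitness_one : HeredityAtOne ↔ HeredityWitness 1`,
  `episodeInductionG_iff_heredityWitness'`, the rung and base forms) — are in the companion
  `PalasekTowerHeredityWitnessUnconditionalRungs.lean` (this seat).

References: H. Sohr, *The Navier–Stokes Equations*, Birkhäuser 2001, Ch. V Thm. 1.5.1 (Serrin,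
Masuda) [cite: Sohr2001, Ch. V Thm. 1.5.1]; T. Tao, Anal. PDE 6 (2013), Lemma 4.1 (i)
[cite: Tao2011, Lemma 4.1]; S. Palasek, arXiv:2605.13827 §4 [cite: Palasek2026ElementaryModel, §4];
R. T. Seeley, Proc. AMS 15 (1964) 625–626 [cite: Seeley1964, Theorem].
-/

noncomputable section

namespace Summit.NavierStokesRegularity.FluidComputer.PalasekTowerClayBridge

open Set MeasureTheory Filter Topology Function Real
open scoped ENNReal ContDiff NNReal
open Literature.Analysis.FluidPDE
open Summit.NavierStokesRegularity.NavierStokesRegularity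

/-! ## §1 A bounded classical competitor is unique among finite-energy classical solutions (no W14) -/

/-- The Serrin pair `(4, 6)`: `2/4 + 3/6 ≤ 1` in `ℝ≥0∞`. [folklore] -/
theorem serrinPair_four_six : (2 : ℝ≥0∞) / 4 + 3 / 6 ≤ 1 := by
  have h6 : (3 : ℝ≥0∞) / 6 = 2⁻¹ := by
    rw [ENNReal.div_eq_inv_mul, show (6 : ℝ≥0∞) = 2 * 3 by norm_num,
      ENNReal.mul_inv (Or.inl two_ne_zero) (Or.inl ENNReal.ofNat_ne_top), mul_assoc,
      ENNReal.inv_mul_cancel (by norm_num) (by norm_num), mul_one]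
  have h4 : (2 : ℝ≥0∞) / 4 = 2⁻¹ := by
    rw [ENNReal.div_eq_inv_mul, show (4 : ℝ≥0∞) = 2 * 2 by norm_num,
      ENNReal.mul_inv (Or.inl two_ne_zero) (Or.inl ENNReal.ofNat_ne_top), mul_assoc,
      ENNReal.inv_mul_cancel (by norm_num) (by norm_num), mul_one]
  rw [h6, h4, ENNReal.inv_two_add_inv_two]

/-- **A BOUNDED classical solution is unique among finite-energy classical solutions — WITHOUT
Tao's forced unconditional uniqueness (W14).** Let `ν > 0`, `0 < T`, let `f` be a Clay-class force
(smooth on `[0, ∞) × ℝ³` with Fefferman's space-time decay (5)), and let `(u, p)`, `(v, q)` be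
classical solutions of the forced Navier–Stokes system on `[0, T] × ℝ³` with finite energy
(`sup_{[0,T]} ∫|·|² < ∞`) and the same datum `v 0 = u 0`; suppose `u` is bounded on `[0, T] × ℝ³`.
Then `v = u` on `[0, T]`. Both are Leray–Hopf weak solutions WITH force `f`
(`isLerayHopfOn_of_clayForce'`, fed the THEOREM `tao2011_forced_pressure_normalisation_ae_holds`),
`u ∈ L⁴(0,T;L⁶)` (`memLqLp_four_six_of_bounded`), the force is a.e. jointly measurable and square
integrable on the slab, so Sohr's forced Serrin–Masuda theorem
(`serrinMasuda_weak_strong_uniqueness_forced`, PROVED in the tree) gives `v(t) = u(t)` a.e. for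
`t ∈ (0, T]`; both slices are continuous, so equality holds everywhere, and at `t = 0` by the datum.
[cite: Sohr2001, Ch. V Thm. 1.5.1] -/
theorem velocity_eq_of_bounded_classical {ν T : ℝ} (hν : 0 < ν) (hT : 0 < T)
    {f u v : ℝ → EuclideanSpace ℝ (Fin 3) → EuclideanSpace ℝ (Fin 3)}
    {p q : ℝ → EuclideanSpace ℝ (Fin 3) → ℝ}
    (hs : IsSmoothOnHalfSpace f) (hd : HasRapidSpaceTimeDecay f)
    (hu : IsClassicalNSSolutionOn (Icc 0 T) ν f u p)
    (hEu : ∃ C : ℝ≥0∞, C < ⊤ ∧ ∀ t ∈ Icc 0 T, ∫⁻ x, ‖u t x‖ₑ ^ 2 ≤ C)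
    {B : ℝ} (hB : ∀ t ∈ Icc 0 T, ∀ x, ‖u t x‖ ≤ B)
    (hv : IsClassicalNSSolutionOn (Icc 0 T) ν f v q)
    (hEv : ∃ C : ℝ≥0∞, C < ⊤ ∧ ∀ t ∈ Icc 0 T, ∫⁻ x, ‖v t x‖ₑ ^ 2 ≤ C) (h0 : v 0 = u 0) :
    ∀ t ∈ Icc 0 T, v t = u t := by
  -- both are Leray–Hopf with force `f` (Tao's forced pressure normalisation is a THEOREM of the tree)
  have hP : tao2011_forced_pressure_normalisation_ae := tao2011_forced_pressure_normalisation_ae_holds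
  have hLHu : IsLerayHopfOn T ν f (u 0) u := (isLerayHopfOn_of_clayForce' hP hu hν hT hs hd hEu).1
  have hLHv : IsLerayHopfOn T ν f (u 0) v := by
    have h := (isLerayHopfOn_of_clayForce' hP hv hν hT hs hd hEv).1
    rwa [h0] at h
  -- `u` is the STRONG solution: bounded with finite energy, hence in `L⁴(0,T;L⁶)`
  have hSerrin : MemLqLp 4 6 u (Ioo 0 T) := by
    obtain ⟨A, hA, hb⟩ := hEu
    exact memLqLp_four_six_of_bounded (fun t ht => (hu.contDiff_velocity ht).continuous) hB hA.ne hb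
  have hu₀ : MemLp (u 0) 2 volume := hLHu.memLp 0 ⟨le_rfl, hT.le⟩
  -- forced Serrin–Masuda (THEOREM of the tree): `v(t) = u(t)` a.e. for every `t ∈ (0, T]`
  have hae : ∀ t ∈ Ioc 0 T, v t =ᵐ[volume] u t :=
    serrinMasuda_weak_strong_uniqueness_forced hν hT (clayForce_aestronglyMeasurable_prod' hs T)
      (clayForce_eLpNorm_prod_lt_top' hs hd T) hLHu hu₀ (q := 4) (r := 6) (by norm_num)
      serrinPair_four_six hSerrin hLHv
  -- continuity upgrades a.e. to everywhere; `t = 0` by the common datum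
  intro t ht
  rcases ht.1.eq_or_lt with h | hpos
  · rw [← h, h0]
  · exact (Continuous.ae_eq_iff_eq volume (hv.contDiff_velocity ht).continuous
      (hu.contDiff_velocity ht).continuous).1 (hae t ⟨hpos, ht.2⟩)

/-! ## §1′ A registered stage pins the design's flow on its slab — unconditionally -/

namespace Stage

variable {ν : ℝ} {R : TowerRates} {S : Schedule R} {m m' : Margins R} {k k' : ℕ}

/-- **A stage pins the design's classical flow on `[0, τ k]` — no W14.** Let `s` be a stage at
level `k` of a schedule `S` (any margins, rates, viscosity `ν > 0`) and let `(v, q)` be ANY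
classical solution of the design's forced system on a slab `[0, T'] ⊇ [0, τ k]` from the Clay datum
`S.u₀` with finite energy there. Then `v = s.u` on `[0, τ k]`: the stage is a bounded competitor by
its own register ceiling `‖s.u‖ ≤ c₂ Y_k` on `[0, τ k]`, and `velocity_eq_of_bounded_classical`
applies on the slab `[0, τ k]` (design force = Clay class). [cite: Sohr2001, Ch. V Thm. 1.5.1] -/
theorem velocity_eq_of_classical (hν : 0 < ν) (s : Stage ν R S m k) {T' : ℝ} (hT' : S.τ k ≤ T')
    {v : ℝ → EuclideanSpace ℝ (Fin 3) → EuclideanSpace ℝ (Fin 3)}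
    {q : ℝ → EuclideanSpace ℝ (Fin 3) → ℝ}
    (hv : IsClassicalNSSolutionOn (Icc 0 T') ν S.f v q) (hv0 : v 0 = S.u₀)
    (hEv : ∃ C : ℝ≥0∞, C < ⊤ ∧ ∀ t ∈ Icc 0 T', ∫⁻ x, ‖v t x‖ₑ ^ 2 ≤ C) :
    ∀ t ∈ Icc 0 (S.τ k), v t = s.u t := by
  have hτ : 0 < S.τ k := S.τ_pos k
  have hvk : IsClassicalNSSolutionOn (Icc 0 (S.τ k)) ν S.f v q :=
    hv.mono (Icc_subset_Icc le_rfl hT') (uniqueDiffOn_Icc hτ)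
  have hEvk : ∃ C : ℝ≥0∞, C < ⊤ ∧ ∀ t ∈ Icc 0 (S.τ k), ∫⁻ x, ‖v t x‖ₑ ^ 2 ≤ C := by
    obtain ⟨C, hC, hb⟩ := hEv
    exact ⟨C, hC, fun t ht => hb t ⟨ht.1, ht.2.trans hT'⟩⟩
  exact velocity_eq_of_bounded_classical hν hτ S.force_smooth S.force_decay s.classical s.energy
    (s.ceiling k le_rfl) hvk hEvk (hv0.trans s.initial.symm)

/-- **Stages of one schedule share their velocity — W14-free twin of `velocity_eq_of_le`.** Two
stages of the same schedule at levels `k ≤ k'`, for possibly different margins, have the same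
velocity on `[0, τ k]`. [cite: Sohr2001, Ch. V Thm. 1.5.1] -/
theorem velocity_eq_of_le' (hν : 0 < ν) (hk : k ≤ k') (s : Stage ν R S m k)
    (s' : Stage ν R S m' k') : ∀ t ∈ Icc 0 (S.τ k), s'.u t = s.u t :=
  s.velocity_eq_of_classical hν (S.τ_mono hk) s'.classical s'.initial s'.energy

/-- Same level, any two margins: the velocities coincide on the whole slab — W14-free twin of
`velocity_eq`. [cite: Sohr2001, Ch. V Thm. 1.5.1] -/
theorem velocity_eq' (hν : 0 < ν) (s : Stage ν R S m k) (s' : Stage ν R S m' k) :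
    ∀ t ∈ Icc 0 (S.τ k), s'.u t = s.u t :=
  velocity_eq_of_le' hν le_rfl s s'

/-- Any stage at level `k + 1` of the same schedule agrees with a stage at level `k` on `[0, τ k]`
in velocity (only the pressure gauge is constrained by `Stage.Extends`) — W14-free twin of
`velocity_extends`. [cite: Sohr2001, Ch. V Thm. 1.5.1] -/
theorem velocity_extends' (hν : 0 < ν) (s : Stage ν R S m k) (s' : Stage ν R S m' (k + 1)) :
    ∀ t ∈ Icc 0 (S.τ k), s'.u t = s.u t :=
  velocity_eq_of_le' hν (Nat.le_succ k) s s'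

/-- **A continuation carrying the next window ceiling is THE flow of the design up to `τ (k+1)` —
no W14, every level (the `k ≤ 1` corner included).** Given a stage `s` at level `k`, a classical
finite-energy solution `(v, q)` of the design's system on `[0, τ (k+1)]` from the Clay datum that
stays below `c₂ Y_{k+1}` on the growth window `[τ k, τ (k+1)]` (e.g. a level witness) is bounded on
the whole slab (`= s.u`, hence `≤ c₂ Y_k`, before `τ k`), so every other classical finite-energy
solution from the datum on that slab coincides with it. [cite: Sohr2001, Ch. V Thm. 1.5.1] -/
theorem velocity_eq_of_window_ceiling (hν : 0 < ν) (s : Stage ν R S m k)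
    {v w : ℝ → EuclideanSpace ℝ (Fin 3) → EuclideanSpace ℝ (Fin 3)}
    {q r : ℝ → EuclideanSpace ℝ (Fin 3) → ℝ}
    (hv : IsClassicalNSSolutionOn (Icc 0 (S.τ (k + 1))) ν S.f v q) (hv0 : v 0 = S.u₀)
    (hEv : ∃ C : ℝ≥0∞, C < ⊤ ∧ ∀ t ∈ Icc 0 (S.τ (k + 1)), ∫⁻ x, ‖v t x‖ₑ ^ 2 ≤ C)
    (hceilW : ∀ t ∈ Icc (S.τ k) (S.τ (k + 1)), ∀ x, ‖v t x‖ ≤ S.c₂ * R.Y (k + 1))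
    (hw : IsClassicalNSSolutionOn (Icc 0 (S.τ (k + 1))) ν S.f w r) (hw0 : w 0 = S.u₀)
    (hEw : ∃ C : ℝ≥0∞, C < ⊤ ∧ ∀ t ∈ Icc 0 (S.τ (k + 1)), ∫⁻ x, ‖w t x‖ₑ ^ 2 ≤ C) :
    ∀ t ∈ Icc 0 (S.τ (k + 1)), w t = v t := by
  have hτle : S.τ k ≤ S.τ (k + 1) := S.τ_mono (Nat.le_succ k)
  have hvel : ∀ t ∈ Icc 0 (S.τ k), v t = s.u t := s.velocity_eq_of_classical hν hτle hv hv0 hEv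
  -- `v` is bounded on the whole slab by `c₂ Y_{k+1}`
  have hB : ∀ t ∈ Icc 0 (S.τ (k + 1)), ∀ x, ‖v t x‖ ≤ S.c₂ * R.Y (k + 1) := by
    intro t ht x
    rcases le_or_gt t (S.τ k) with htk | htk
    · rw [hvel t ⟨ht.1, htk⟩]
      exact (s.ceiling k le_rfl t ⟨ht.1, htk⟩ x).trans
        (mul_le_mul_of_nonneg_left (R.Y_le_Y_succ k) s.c₂_pos.le)
    · exact hceilW t ⟨htk.le, ht.2⟩ x
  exact velocity_eq_of_bounded_classical hν (S.τ_pos (k + 1)) S.force_smooth S.force_decay hv hEv hB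
    hw hEw (hw0.trans hv0.symm)

/-! ## §2 The stage-relative reduction: velocity agreement suffices (no uniqueness at all) -/

/-- **Assembling the extension from a continuation that agrees with the stage IN VELOCITY only**
(margins `routeG`, any rates, any viscosity; no uniqueness hypothesis whatsoever — the
stage-relative form of the reduction): let `s` be a globally anchored registered stage at level `k`
and `(v, q)` a classical finite-energy solution of the design's system on `[0, τ (k+1)]` with
`v = s.u` on `[0, τ k]` (ANY pressure gauge `q`), below `c₂ Y_{k+1}` on the growth window
`[τ k, τ (k+1)]` and meeting the three floors of level `k + 1` at `τ (k+1)`. Then `s` extends to a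
registered stage at level `k + 1`. The pressures differ on `[0, τ k]` by a function of time alone up
to the endpoints (`pressure_gauge_eq_of_velocity_eq`); that gauge, smooth on `[0, τ k]`, extends
smoothly past `τ k` (`exists_contDiffOn_Ici_extension`, Seeley), and re-gauging `q` by it gives a
continuation agreeing with `s` in velocity AND pressure, below `c₂ Y_{k+1}` throughout (before `τ k`
by the stage's ceiling and `Y_k ≤ Y_{k+1}`); `exists_extends_of_continuation` assembles.
[cite: Seeley1964, Theorem] -/
theorem exists_extends_of_velocity_continuation (s : Stage ν R S (Margins.routeG R) k)
    {v : ℝ → EuclideanSpace ℝ (Fin 3) → EuclideanSpace ℝ (Fin 3)}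
    {q : ℝ → EuclideanSpace ℝ (Fin 3) → ℝ}
    (hcl : IsClassicalNSSolutionOn (Icc 0 (S.τ (k + 1))) ν S.f v q)
    (hvel : ∀ t ∈ Icc 0 (S.τ k), v t = s.u t)
    (henergy : ∃ C : ℝ≥0∞, C < ⊤ ∧ ∀ t ∈ Icc 0 (S.τ (k + 1)), ∫⁻ x, ‖v t x‖ₑ ^ 2 ≤ C)
    (hceilW : ∀ t ∈ Icc (S.τ k) (S.τ (k + 1)), ∀ x, ‖v t x‖ ≤ S.c₂ * R.Y (k + 1))
    (hfloor : ∃ x, ‖x‖ ≤ S.radius ∧ S.c₁ * R.Y (k + 1) ≤ ‖v (S.τ (k + 1)) x‖)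
    (hstrain : ∃ x, ‖x‖ ≤ S.radius ∧ S.c₁ * R.A (k + 1) ≤ ‖fderiv ℝ (v (S.τ (k + 1))) x‖)
    (hcore : ∃ (x : EuclideanSpace ℝ (Fin 3)) (γ : ℝ → EuclideanSpace ℝ (Fin 3)),
      ‖x‖ ≤ S.radius ∧ ContDiff ℝ 1 γ ∧ γ 0 = γ 1 ∧
      (∀ σ ∈ Icc (0 : ℝ) 1, γ σ ∈ Metric.closedBall x (1 / R.N (k + 1))) ∧
      (∀ σ ∈ Icc (0 : ℝ) 1, ‖deriv γ σ‖ ≤ 8 * π / R.N (k + 1)) ∧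
      S.c₁ * R.N (k + 1) ^ (R.β - 2) ≤ circulation (v (S.τ (k + 1))) γ) :
    ∃ s' : Stage ν R S (Margins.routeG R) (k + 1), s.Extends s' := by
  have hrig : S.Rigid := s.routeG_rigid
  have hτk : 0 < S.τ k := S.τ_pos k
  have hτle : S.τ k ≤ S.τ (k + 1) := S.τ_mono (Nat.le_succ k)
  -- (1) pressure gauge: `s.p t x - s.p t 0 = q t x - q t 0` on `[0, τ k]`
  have hgauge : ∀ t ∈ Icc 0 (S.τ k), ∀ x, s.p t x - s.p t 0 = q t x - q t 0 :=
    pressure_gauge_eq_of_velocity_eq hτk hτle s.classical hcl hvel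
  -- the gauge function `t ↦ s.p t 0 - q t 0`, smooth on `[0, τ k]`, extended past `τ k`
  have hslice0 : ∀ {T : ℝ} {w : ℝ → EuclideanSpace ℝ (Fin 3) → ℝ}, IsSmoothSpaceTimeOn (Icc 0 T) w →
      ContDiffOn ℝ ∞ (fun t => w t 0) (Icc 0 T) := by
    intro T w hw
    have hc : ContDiff ℝ ∞ (fun t : ℝ => ((t, (0 : EuclideanSpace ℝ (Fin 3))) :
        ℝ × EuclideanSpace ℝ (Fin 3))) := contDiff_id.prodMk contDiff_const
    exact hw.comp hc.contDiffOn (fun t ht => mk_mem_prod ht (mem_univ _))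
  have hc_smooth : ContDiffOn ℝ ∞ (fun t => s.p t 0 - q t 0) (Icc 0 (S.τ k)) :=
    (hslice0 s.classical.smooth_pressure).sub
      ((hslice0 hcl.smooth_pressure).mono (Icc_subset_Icc le_rfl hτle))
  obtain ⟨e, he, hec⟩ := exists_contDiffOn_Ici_extension hτk hc_smooth
  -- (2) the re-gauged pressure `P t x = q t x - (- e t)` and the continuation `(v, P)`
  set P : ℝ → EuclideanSpace ℝ (Fin 3) → ℝ := fun t x => q t x - (-e t) with hP
  have hPcl : IsClassicalNSSolutionOn (Icc 0 (S.τ (k + 1))) ν S.f v P := by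
    refine ⟨hcl.smooth_velocity, ?_, ?_, hcl.divFree⟩
    · -- joint smoothness of `q + e ∘ fst`
      have he' : ContDiffOn ℝ ∞ (fun z : ℝ × EuclideanSpace ℝ (Fin 3) => -e z.1)
          (Icc 0 (S.τ (k + 1)) ×ˢ univ) :=
        (he.comp contDiff_fst.contDiffOn (fun z hz => (hz.1 : z.1 ∈ Icc 0 (S.τ (k + 1))).1)).neg
      exact ContDiffOn.sub hcl.smooth_pressure he'
    · intro t ht x
      have hg : gradient (P t) x = gradient (q t) x := gradient_sub_const (q t) (-e t) x
      rw [hg]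
      exact hcl.momentum t ht x
  have hagree : ∀ t ∈ Icc 0 (S.τ k), v t = s.u t ∧ P t = s.p t := by
    intro t ht
    refine ⟨hvel t ht, funext fun x => ?_⟩
    have h1 := hgauge t ht x
    have h2 : e t = s.p t 0 - q t 0 := hec ht
    show q t x - (-e t) = s.p t x
    linarith
  -- (3) the ceiling on the whole slab
  have hceil : ∀ t ∈ Icc 0 (S.τ (k + 1)), ∀ x, ‖v t x‖ ≤ S.c₂ * R.Y (k + 1) := by
    intro t ht x
    rcases le_or_gt t (S.τ k) with htk | htk
    · rw [hvel t ⟨ht.1, htk⟩]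
      refine (s.ceiling k le_rfl t ⟨ht.1, htk⟩ x).trans ?_
      exact mul_le_mul_of_nonneg_left (R.Y_le_Y_succ k) s.c₂_pos.le
    · exact hceilW t ⟨htk.le, ht.2⟩ x
  exact s.exists_extends_of_continuation hrig hPcl hagree henergy hceil hfloor hstrain hcore

/-! ## §3 THE REDUCTION, unconditional -/

/-- **THE REDUCTION — a level witness extends every registered stage of its design; NO uniqueness
hypothesis** (any rates, any viscosity `ν > 0`; the W14-free twin of p417894's
`nonempty_extends_of_levelWitness (hU)`). The witness flow IS the stage's velocity on `[0, τ k]`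
by `velocity_eq_of_classical` (the stage is bounded by its register ceiling; forced Serrin–Masuda,
a theorem of the tree), and `exists_extends_of_velocity_continuation` re-gauges the pressure and
assembles the level-`k+1` stage. [cite: Sohr2001, Ch. V Thm. 1.5.1] -/
theorem nonempty_extends_of_levelWitness' (hν : 0 < ν) (s : Stage ν R S (Margins.routeG R) k)
    (hW : S.LevelWitness ν k) :
    ∃ s' : Stage ν R S (Margins.routeG R) (k + 1), s.Extends s' := by
  obtain ⟨v, q, hcl, hv0, henergy, hceilW, hfloor, hstrain, hcore⟩ := hW
  have hvel : ∀ t ∈ Icc 0 (S.τ k), v t = s.u t :=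
    s.velocity_eq_of_classical hν (S.τ_mono (Nat.le_succ k)) hcl hv0 henergy
  exact s.exists_extends_of_velocity_continuation hcl hvel henergy hceilW hfloor hstrain hcore

/-- **The level witness of a design that earned a stage is canonical** (no W14): its velocity is
determined on `[0, τ (k+1)]` — any classical finite-energy solution of the design's system from the
Clay datum on that slab coincides with it (`velocity_eq_of_window_ceiling`). So «the design's own
flow certifies level `k + 1`» speaks of ONE flow. [cite: Sohr2001, Ch. V Thm. 1.5.1] -/
theorem levelWitness_velocity_unique (hν : 0 < ν) (s : Stage ν R S m k)
    {v w : ℝ → EuclideanSpace ℝ (Fin 3) → EuclideanSpace ℝ (Fin 3)}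
    {q r : ℝ → EuclideanSpace ℝ (Fin 3) → ℝ}
    (hv : IsClassicalNSSolutionOn (Icc 0 (S.τ (k + 1))) ν S.f v q) (hv0 : v 0 = S.u₀)
    (hEv : ∃ C : ℝ≥0∞, C < ⊤ ∧ ∀ t ∈ Icc 0 (S.τ (k + 1)), ∫⁻ x, ‖v t x‖ₑ ^ 2 ≤ C)
    (hceilV : ∀ t ∈ Icc (S.τ k) (S.τ (k + 1)), ∀ x, ‖v t x‖ ≤ S.c₂ * R.Y (k + 1))
    (hw : IsClassicalNSSolutionOn (Icc 0 (S.τ (k + 1))) ν S.f w r) (hw0 : w 0 = S.u₀)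
    (hEw : ∃ C : ℝ≥0∞, C < ⊤ ∧ ∀ t ∈ Icc 0 (S.τ (k + 1)), ∫⁻ x, ‖w t x‖ₑ ^ 2 ≤ C) :
    ∀ t ∈ Icc 0 (S.τ (k + 1)), ∀ x, w t x = v t x := fun t ht x => by
  rw [s.velocity_eq_of_window_ceiling hν hv hv0 hEv hceilV hw hw0 hEw t ht]

end Stage

end Summit.NavierStokesRegularity.FluidComputer.PalasekTowerClayBridge

end
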